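import Literature.Computability.Cryptography.ChenQuantumLWEReadoutJoint
import Literature.Computability.Cryptography.ChenQuantumLWEReadoutDatumValue
import Literature.Computability.Cryptography.ChenQuantumLWEDatumValueClosedForm

/-!
# Chen's Step 8 read-out value, all clauses in one place: every `Q`, every number of copies, closed form

REPRODUCTION / ANALYSIS OF A CLAIMED RESULT UNDER ADJUDICATION (withdrawn): Yilei Chen, *Quantum
Algorithms for Lattice Problems*, IACR ePrint 2024/555, version of 2024-04-18 [ChenQuantumLattice2024]
(the version carrying the author's note that Step 9 contains a bug), Steps 8–9 (§3.5.8–§3.5.9,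
pp. 34–38).  Bundle `papers/QuantumAdvantage/lwe-quantum-autopsy/`, Part 1: a SUMMARY module joining
(V) `ChenQuantumLWEReadoutJoint` (several copies), (W) `ChenQuantumLWEReadoutDatumValue` (Part 1's
constant = Part 2's value) and Part 2's `ChenQuantumLWEDatumValueClosedForm` (`gcd` / divisor sums).
HONEST FRAMING: kernel-checked one-line COROLLARIES of already landed theorems about registers of a
WITHDRAWN algorithm, stated in the form a referee quotes — a precise NEGATIVE result made explicit; NOT
summit progress, no cryptanalytic claim in either direction, no new algorithm for any lattice problem.

## What is proved

* `mul_pairsCountT_eq_sum_gcd_pow`, `pairsCountT_div_eq_sum_gcd_pow`, `pairsCountT_div_eq_sum_divisors`: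
  Part 1's read-out constant in arithmetic closed form for EVERY modulus,
  `pairsCountT(Q,T)/Q^{2n} = Q^{-(#T+1)}·Σ_{σ∈ℤ_Q} gcd(Q,σ)^{#T} = Q^{-(#T+1)}·Σ_{d∣Q} φ(Q/d)·d^{#T}`;
* `pairsCountT_div_eq_one_fifth`: the worked instance `Q = 15`, `#T = 1`: the value is `1/5` (any `n`);
* **`Shape.step9Needs_readout_value_joint_datumValue`**: the minimax read-out value of the Step-9 datum
  from the reference Step-8 register measured JOINTLY with any finite family of companion Step-8
  registers (same slopes, own unknown offsets) is `V(Q, #T_U)·⟨Ψ|Ψ⟩` with `V = datumValue` of census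
  T13 — both sides ((V)'s `step9Needs_readout_value_joint` with (W)'s identification);
* `Shape.readoutConst_eq_sum_divisors`: that constant for Chen's `Q` written as the divisor sum.

## Declarations used, not re-proved
(V) `Shape.step9Needs_readout_value_joint`; (W) `mul_pairsCountT_eq_sum_pow`, `pairsCountT_div_eq_datumValue`,
`pairsCountT_div_eq_datumValue_fin`, `Shape.readoutConst_eq_datumValue`; Part 2 `card_mulKer_eq_gcd`,
`datumValue_eq_sum_gcd_pow`, `datumValue_eq_sum_divisors`, `datumValue_fifteen_one`.
-/

namespace Literature.Computability.Cryptography.Chen2024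

open scoped BigOperators
open Matrix

section ClosedForm

variable (Q : ℕ+) {n : ℕ}

/-- `Q·pairsCountT(Q,T) = Qⁿ·Q^{n−#T}·Σ_{σ∈ℤ_Q} gcd(Q,σ)^{#T}`. [folklore] -/
theorem mul_pairsCountT_eq_sum_gcd_pow (T : Finset (Fin n)) :
    ((Q : ℕ+) : ℕ) * pairsCountT (Q : ℕ) T
      = ((Q : ℕ+) : ℕ) ^ n * ((Q : ℕ+) : ℕ) ^ (n - T.card) * ∑ σ : ZQ Q, (Nat.gcd Q σ.val) ^ T.card := by
  rw [mul_pairsCountT_eq_sum_pow]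
  simp_rw [card_mulKer_eq_gcd]

/-- `pairsCountT(Q,T)/Q^{2n} = Q^{-(#T+1)}·Σ_{σ∈ℤ_Q} gcd(Q,σ)^{#T}`. [folklore] -/
theorem pairsCountT_div_eq_sum_gcd_pow (T : Finset (Fin n)) :
    (pairsCountT (Q : ℕ) T : ℝ) / (((Q : ℕ+) : ℕ) : ℝ) ^ (2 * n)
      = (∑ σ : ZQ Q, ((Nat.gcd Q σ.val : ℕ) : ℝ) ^ T.card) / (((Q : ℕ+) : ℕ) : ℝ) ^ (T.card + 1) := by
  rw [pairsCountT_div_eq_datumValue_fin, datumValue_eq_sum_gcd_pow, Fintype.card_fin]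

/-- `pairsCountT(Q,T)/Q^{2n} = Q^{-(#T+1)}·Σ_{d ∣ Q} φ(Q/d)·d^{#T}`. [folklore] -/
theorem pairsCountT_div_eq_sum_divisors (T : Finset (Fin n)) :
    (pairsCountT (Q : ℕ) T : ℝ) / (((Q : ℕ+) : ℕ) : ℝ) ^ (2 * n)
      = (∑ d ∈ ((Q : ℕ+) : ℕ).divisors,
            (Nat.totient (((Q : ℕ+) : ℕ) / d) : ℝ) * ((d : ℕ) : ℝ) ^ T.card)
          / (((Q : ℕ+) : ℕ) : ℝ) ^ (T.card + 1) := by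
  rw [pairsCountT_div_eq_datumValue_fin, datumValue_eq_sum_divisors, Fintype.card_fin]

/-- Worked instance: `Q = 15`, one obstructing dummy (`#T = 1`): `pairsCountT(15,T)/15^{2n} = 1/5`
(`= (15 + 2·5 + 4·3 + 8·1)/225`). [folklore] -/
theorem pairsCountT_div_eq_one_fifth (T : Finset (Fin n)) (hT : T.card = 1) :
    (pairsCountT ((15 : ℕ+) : ℕ) T : ℝ) / (((15 : ℕ+) : ℕ) : ℝ) ^ (2 * n) = 1 / 5 := by
  rw [pairsCountT_div_eq_datumValue 15 T (Fin 1) (by rw [Fintype.card_fin, hT])]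
  exact datumValue_fifteen_one (Fintype.card_fin 1)

end ClosedForm

end Literature.Computability.Cryptography.Chen2024

namespace Literature.Computability.Cryptography.Chen2024.Shape

open scoped BigOperators ComplexOrder
open Matrix

variable (S : Shape)

/-- **Several copies, every `Q`: the value is `V(Q, #T_U)·⟨Ψ|Ψ⟩`** — (V)'s `step9Needs_readout_value_joint`
with its constant identified as census T13's `datumValue` ((W) `readoutConst_eq_datumValue`): for every
finite family `κ` of companion Step-8 registers (same slopes, base offsets `w_k ∈ Dℤⁿ⁺¹`, own unknown
family parameters), (i) every joint POVM + decoder fails on some class instance and companion tuple at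
`V(Q, #T_U)·⟨Ψ|Ψ⟩`; (ii) the class measurement on the reference register alone attains it everywhere.
[cite: ChenQuantumLattice2024, §3.5.8–§3.5.9 pp. 34–37] -/
theorem step9Needs_readout_value_joint_datumValue (h : S.Admissible) (U : Finset (Fin (S.n + 1)))
    {κ : Type*} [Fintype κ] [DecidableEq κ] {w : κ → Fin (S.n + 1) → ℤ} (hw : ∀ k i, (S.D : ℤ) ∣ w k i) :
    (∀ {A : Type*} [Fintype A] [DecidableEq A]
        (E : POVM ((Fin (S.n + 1) → ZMod S.M) × (κ → Fin (S.n + 1) → ZMod S.M)) A) (dec : A → ZMod S.N),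
      ∃ (b₂ v₂ : Fin (S.n + 1) → ℤ) (t : κ → ZMod S.Q × (Fin S.n → ZMod S.Q)),
        S.InClass U b₂ v₂ ∧ (∀ k, S.InClass U b₂ (S.compOffset (w k) (t k))) ∧
        (∑ a ∈ Finset.univ.filter (fun a => dec a = (S.inst b₂ v₂).step9Needs),
            (E.weight (tensorKet (S.inst b₂ v₂).phi7d (S.compKet w b₂ t)) a).re)
          ≤ datumValue S.Q (Fin (S.tailSet U).card)
              * (star (tensorKet (S.inst b₂ v₂).phi7d (S.compKet w b₂ t))
                  ⬝ᵥ tensorKet (S.inst b₂ v₂).phi7d (S.compKet w b₂ t)).re) ∧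
    (∀ (b₂ v₂ : Fin (S.n + 1) → ℤ) (t : κ → ZMod S.Q × (Fin S.n → ZMod S.Q)), S.InClass U b₂ v₂ →
      ∑ a ∈ Finset.univ.filter (fun a => S.classDec (S.tailSet U) a = (S.inst b₂ v₂).step9Needs),
          (((S.classPOVM h).tensorOne (κ → Fin (S.n + 1) → ZMod S.M)).weight
              (tensorKet (S.inst b₂ v₂).phi7d (S.compKet w b₂ t)) a).re
        = datumValue S.Q (Fin (S.tailSet U).card)
            * (star (tensorKet (S.inst b₂ v₂).phi7d (S.compKet w b₂ t))
                ⬝ᵥ tensorKet (S.inst b₂ v₂).phi7d (S.compKet w b₂ t)).re) := by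
  rw [← S.readoutConst_eq_datumValue (S.tailSet U)]
  exact S.step9Needs_readout_value_joint h U hw

/-- The value function of both parts in divisor form for Chen's `Q`:
`V(Q, #T) = Q^{-(#T+1)}·Σ_{d∣Q} φ(Q/d)·d^{#T}` equals Part 1's constant. [folklore] -/
theorem readoutConst_eq_sum_divisors (T : Finset (Fin S.n)) :
    (pairsCountT (S.Q : ℕ) T : ℝ) / ((S.Q : ℕ) : ℝ) ^ (2 * S.n)
      = (∑ d ∈ (S.Q : ℕ).divisors, (Nat.totient ((S.Q : ℕ) / d) : ℝ) * ((d : ℕ) : ℝ) ^ T.card)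
          / ((S.Q : ℕ) : ℝ) ^ (T.card + 1) :=
  pairsCountT_div_eq_sum_divisors S.Q T

end Literature.Computability.Cryptography.Chen2024.Shape
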